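import Summits.BirchSwinnertonDyer.BirchSwinnertonDyer.Theorems.PrintCFramBottomClassIndexLawFiveLeSelmerDevissageCountRationalAligned
import Summits.BirchSwinnertonDyer.BirchSwinnertonDyer.Theorems.PrintCFramBottomClassIndexLawFiveLeSelmerCountClassSide
import Summits.BirchSwinnertonDyer.BirchSwinnertonDyer.Theorems.PrintCFramBottomClassIndexLawFiveLeLevelDictionaryAlpha
import Summits.BirchSwinnertonDyer.BirchSwinnertonDyer.Theorems.PrintCFramBottomClassIndexLawFiveLeParitySplitRegistrable
import HarnessLib

/-!
# Route `PrintCFram`, crux C2 `BottomClassIndexLawFiveLe` (stmt-BirchSwinnertonDyer-20372), line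
# `eisenstein-resource-bdp-line` (registry v19, stub B1 `stub_bsdp_of_classFactor`): **THE SELMER COUNT ON THE CLASS, CASE S** —
# `v_p(B_{1,ψ⁻¹}) = 1 ∧ CASE S ⟹ #Sel_p(W/ℚ) ≤ p²`, hence (parity split) `B1 ⟸ p ∤ #Ш_an(W)` there
# (cell `bsd-print-cfram`, width seat `bsd-line-cfram-p1-w2` g9; helper `--supports` 20372; 0 defs, 0 facts, 0 sorry;
# CONDITIONAL on Mazur–Wiles Thm 2 (`hMW`) and, for the `BSD_p` corollary, on Cassels–Tate (`hCT`) and GZK)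

HONEST FRAMING. Nothing about BSD is proved unconditionally here and no stub is closed; B1 is NOT proved (its residue on this
branch is the `p`-indivisibility of `#Ш_an(W)`, i.e. the Heegner `p`-primitivity — w3 g8/g9's sockets). This file is the
END-TO-END ASSEMBLY, on B1's own binders, of the structure announced by LEAD g11 (22:11:05Z (1): «on B1 ∩ {#Sel_p ≤ p²}, BSD_p ⟺
p ∤ #Ш_an(W)») for the FIRST-ORDER branch: the class factor has EXACT valuation one (`‖B_{1,ψ⁻¹}‖_p = p⁻¹`) and the member is in
CASE S. Pieces: w6 g3's rational-line data (`LevelDictionaryAlpha.exists_rationalLineData_of_hss`: the line `Φ = W[𝔭]`, the two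
characters `θ_S, θ_Q` with Dirichlet avatars, `ψ ~ ψ₁` or `ψ ~ ψ₁⁻¹ω`) and local inputs; the Selmer count of w2 g9
(`SelmerCount.natCard_selmerGroup_le_of_transverse` / `…_of_aligned`); the class side of w7 g3 + w2 g9
(`SelmerCountClassSide.natCard_strict_le_pow_of_odd_avatar` / `…natCard_h1Unramified_le_pow_of_even_avatar`: bridge, Hilbert class
field / Kummer reflection counts, Mazur–Wiles); the parity glue of w2 g8 (`ParitySplit.bsdp_of_natCard_selmerGroup_le_sq`).

CASE S (LEAD g10 report §2(a), seat notes w2g8 §4 / w2g9 §2–3), intrinsically on the model `W`: «if the rational line `Φ` is ODD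
(complex conjugation acts by `−1` on it) then `W` is TRANSVERSE at `p` along `Φ` (every `w : Γ_ℚ → Φ` whose push-forward is Selmer
is a coboundary on `D_p`); if `Φ` is EVEN then `W` is ALIGNED (every Selmer cocycle pushed to `W[p]/Φ` is a coboundary on `D_p`)».
Of the `p`-isogenous pair `{W_ψ, W_e}` exactly one satisfies each alternative; CASE S says the model with odd sub character is the
transverse one (expected ⟺ `v_p(Δ_min(W_ψ)) < 6`, seat notes w2g9 §3 — not a kernel statement).

* **`natCard_selmerGroup_le_sq_of_caseS`** — `W/ℚ` globally minimal with CM, `p ≥ 5` CM-ramified, odd Kriz–Li datum `(f, ψ, ω)`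
  with `hss`, **`‖B_{1,ψ⁻¹}‖_p = p⁻¹`**, `hMW`, `v ∋ p`, CASE S ⊢ **`#Sel_p(W/ℚ) ≤ p²`**.
* **`bsdp_of_caseS_of_shaAnUnit`** — + `hCT`, GZK, `r_an(W) = 1`, `#Ш_an(W) = q` with `padicValRat p q = 0` ⊢ **`BSDp W p`**.
  In dimensions: both residual groups have `≤ p` elements (w7: `u_str(ψ) ≤ 1`, `u_rel(θ_e) ≤ 1` at `v_p = 1`), the transverse /
  aligned count gives `≤ p²`, Cassels–Tate parity gives `Ш(W)[p^∞] = 0`.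
* (append) **`sha_noPTorsion_of_caseS`** (on this branch `Ш(W)[p] = 0`) and **`bsdp_iff_shaAnUnit_of_caseS`** (`BSDp W p ↔ p ∤ #Ш_an(W)`),
  through w3 g8's `ParitySplit.noPTorsion_of_natCard_selmerGroup_le_sq` / `bsdp_iff_shaAn_unit_of_natCard_selmerGroup_le_sq`;
  (append) **`bsdp_of_sha_ne_zero_of_caseS`** — LEAD g11's «B1-sha» (`∃ s ∈ W.sha, s ≠ 0 ∧ p • s = 0 ⟹ BSDp W p`) holds VACUOUSLY on
  this branch.

THEOREMS ONLY; no definition, no named fact, no `sorry`. BSD is not proved by any of this; no summit statement is proved by this seat.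
References: [SilvermanAEC2009] X.§4; [MazurWiles1984] Thm. 2 (p. 216); [Washington1997] §6.3, §10.2; [Cassels1962ArithmeticIV];
[GreenbergLNM1716] §3; [KrizLi2019] §1.5, §7.1; the LEAD g10 report §2, seat notes w2g8 §4, w2g9, w7g3.
-/

set_option autoImplicit false
-- `…BirchSwinnertonDyer.BirchSwinnertonDyer.Theorems…` is the problem's mandated namespace (D-0017).
set_option linter.dupNamespace false

noncomputable section

open scoped Classical Pointwise

namespace Summit.BirchSwinnertonDyer.BirchSwinnertonDyer.Theorems.PrintCFram.SelmerCount

open NumberField IsDedekindDomain Field WeierstrassCurve DirichletCharacter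
open Literature.NumberTheory.NumberFields Literature.NumberTheory.EllipticCurves Literature.NumberTheory.GaloisRepresentations
  Literature.NumberTheory.EllipticCurves.Rank1Residual Literature.NumberTheory.EllipticCurves.KrizLi2019
  Literature.NumberTheory.EllipticCurves.GreenbergSelmer
open Summit.BirchSwinnertonDyer.Rank1Residual Summit.BirchSwinnertonDyer.Rank1Residual.X2.ResidualDevissageModules
open Summit.BirchSwinnertonDyer.BirchSwinnertonDyer.Theorems.PrintCFram.HerbrandSelmerToHom
open Summit.BirchSwinnertonDyer.BirchSwinnertonDyer.Theorems.PrintCFram.LevelDictionaryAlpha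

variable {p : ℕ} [hp : Fact p.Prime]
variable (W : WeierstrassCurve ℚ) [W.IsElliptic] [W.IsGloballyMinimal]

/-- **THE SELMER COUNT ON THE CLASS, CASE S: `#Sel_p(W/ℚ) ≤ p²`.** `W/ℚ` globally minimal with CM, `p ≥ 5` ramified in the CM field,
`(f, ψ, ω)` a Kriz–Li character datum with `ψ` ODD, `ω` Teichmüller and the trace form `hss`; the class factor has EXACT valuation
one, `‖B_{1,ψ⁻¹}‖_p = p⁻¹`; `hMW` (Mazur–Wiles Thm 2); `v` the place above `p`; and CASE S: for every `Γ_ℚ`-stable line `Φ ≤ W[p]` of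
order `p` and every complex conjugation `c`, if `c` acts by `−1` on `Φ` then `W` is TRANSVERSE at `p` along `Φ`, and if `c` acts
trivially on `Φ` then `W` is ALIGNED. THEN `#Sel_p(W/ℚ) ≤ p²`. PROOF: the rational line `Φ = W[𝔭]` with characters `θ_S, θ_Q` and
avatars (`exists_rationalLineData_of_hss`); if `θ_S` is odd (`ψ ~ ψ₁`), TRANSVERSE and `#Sel_p ≤ #R_rel(Φ.Quot)·#R_str(Φ.Sub)` with
`#R_rel(θ_Q = even) ≤ p` (Kummer reflection count + MW on the reflected odd character `~ψ`) and `#R_str(θ_S ~ ψ) ≤ p` (Hilbert class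
field count + MW); if `θ_S` is even (`ψ ~ ψ₁⁻¹ω`), ALIGNED and the two roles are exchanged.
[cite: SilvermanAEC2009, X.§4 (Cor. 4.4, Ex. 4.8)] [cite: MazurWiles1984, Thm. 2 (p. 216)] [cite: Washington1997, §10.2 and §6.3]
[cite: GreenbergLNM1716, §3 (PDF p. 86)] -/
theorem natCard_selmerGroup_le_sq_of_caseS (hMW : MazurWiles1984.thm2_card_oddChiClassGroup_eq_bernoulli)
    (hCM : W.HasCM) (hram : CMRamified W p) (h5 : 5 ≤ p)
    {f : ℕ} [NeZero f] (ψ : DirichletCharacter ℚ_[p] f) (ω : DirichletCharacter ℚ_[p] p)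
    (hψ : ψ.Odd) (hω : IsTeichmullerCharacter ω)
    (hss : ∀ ℓ : ℕ, ℓ.Prime → ¬ (ℓ ∣ p * W.conductorNorm ℤ) →
      ‖((W.LFunction ℓ : ℤ) : ℚ_[p]) - (ψ (ℓ : ZMod f) + ψ⁻¹ (ℓ : ZMod f) * ω (ℓ : ZMod p))‖ < 1)
    (hB : ‖bernoulliOnePrim ψ⁻¹‖ = (p : ℝ)⁻¹)
    {v : HeightOneSpectrum (𝓞 ℚ)} (hpv : ((p : ℕ) : 𝓞 ℚ) ∈ v.asIdeal)
    (hS : ∀ (Φ : StableSubgroup (absoluteGaloisGroup ℚ) (geomTorsion W (p : ℤ))), Nat.card Φ.Sub = p →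
      ∀ c : absoluteGaloisGroup ℚ, IsComplexConjugation (Rat.castHom ℝ) c →
        ((∀ x : Φ.Sub, c • x = -x) →
          ∀ w : contOneCocycles (discreteTopRep (absoluteGaloisGroup ℚ) Φ.Sub),
            oneCocycleClass (discreteTopRep (absoluteGaloisGroup ℚ) (geomTorsion W (p : ℤ)))
              (contOneCocycles.pullback (ContinuousMonoidHom.id _)
                (resHomOfEquivariant (ContinuousMonoidHom.id _) Φ.incl Φ.incl_smul) w) ∈ selmerGroup W (p : ℤ) →
              ∃ s : Φ.Sub, ∀ g ∈ decomp v, w.1 g = g • s - s) ∧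
        ((∀ x : Φ.Sub, c • x = x) →
          ∀ z : contOneCocycles (discreteTopRep (absoluteGaloisGroup ℚ) (geomTorsion W (p : ℤ))),
            oneCocycleClass _ z ∈ selmerGroup W (p : ℤ) →
              ∃ q : Φ.Quot, ∀ g ∈ decomp v, Φ.proj (z.1 g) = g • q - q)) :
    Nat.card (selmerGroup W (p : ℤ)) ≤ p ^ 2 := by
  have hpr : p.Prime := hp.out
  have hp2 : p ≠ 2 := by omega
  haveI hpne : NeZero p := ⟨hpr.ne_zero⟩
  haveI : Fact (1 < p) := ⟨hpr.one_lt⟩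
  have hωodd : ω.Odd := KrizLiBinders.teichmuller_apply_neg_one hp2 hω
  have hne : ¬ ψ.Even := EisensteinPair.not_even_of_odd' ψ hψ
  have hBp : ‖bernoulliOnePrim ψ⁻¹‖ = ((p : ℝ) ^ 1)⁻¹ := by rw [pow_one]; exact hB
  -- the rational line, its characters and avatars
  obtain ⟨Φ, θS, θQ, m, hmz, b, ψ₁, hfM, hmM, hpM, hcard, hθS, hkerS, hθQ, hkerQ, hprod, hSb, hQb, hψ₁, e⟩ :=
    exists_rationalLineData_of_hss p W hCM h5 hram ψ ω hω hss
  have hcardQ : Nat.card Φ.Quot = p := HerbrandLineRestriction.natCard_quot_eq_of_card_sub W Φ hcard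
  have hcontS : ∀ x : Φ.Sub, Continuous fun g : absoluteGaloisGroup ℚ ↦ g • x :=
    Φ.continuous_smul_sub (LevelDictionary.continuous_smul_geomTorsion W (p : ℤ))
  have hcontQ : ∀ y : Φ.Quot, Continuous fun g : absoluteGaloisGroup ℚ ↦ g • y :=
    Φ.continuous_smul_quot (LevelDictionary.continuous_smul_geomTorsion W (p : ℤ))
  have hpS : ∀ x : Φ.Sub, (p : ℤ) • x = 0 := fun x ↦ by
    rw [natCast_zsmul]; exact HerbrandLineRestriction.prime_nsmul_eq_zero_of_card_prime hcard x
  -- non-trivial action and the decomposition witnesses at `p`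
  obtain ⟨𝔓₀, h𝔓₀⟩ := v.primesAbove_nonempty
  obtain ⟨g₀, -, -, c₀, hc₀, hg₀⟩ := BorelTorsion.exists_sq_mem_inertia_homothety (W := W) p hCM h5 hram hpv h𝔓₀
  have hntS : ∃ (g : absoluteGaloisGroup ℚ) (x : Φ.Sub), g • x ≠ x := by
    haveI : Finite Φ.Sub := Nat.finite_of_card_ne_zero (by rw [hcard]; exact hpr.ne_zero)
    haveI : Nontrivial Φ.Sub := Finite.one_lt_card_iff_nontrivial.mp (by rw [hcard]; exact hpr.one_lt)
    obtain ⟨x, hx⟩ := exists_ne (0 : Φ.Sub)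
    exact ⟨g₀, x, HerbrandInertiaAtP.smul_ne_sub_of_homothety W Φ hcard hc₀ hg₀ hx⟩
  have hntQ : ∃ (g : absoluteGaloisGroup ℚ) (y : Φ.Quot), g • y ≠ y := by
    haveI : Finite Φ.Quot := Nat.finite_of_card_ne_zero (by rw [hcardQ]; exact hpr.ne_zero)
    haveI : Nontrivial Φ.Quot := Finite.one_lt_card_iff_nontrivial.mp (by rw [hcardQ]; exact hpr.one_lt)
    obtain ⟨y, hy⟩ := exists_ne (0 : Φ.Quot)
    exact ⟨g₀, y, HerbrandInertiaAtP.smul_ne_quot_of_homothety W Φ hcard hc₀ hg₀ hy⟩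
  have HS : ∀ (ℓ : HeightOneSpectrum (𝓞 ℚ)), ((p : ℕ) : 𝓞 ℚ) ∈ ℓ.asIdeal → ∀ 𝔓 ∈ ℓ.primesAbove,
      ∃ g ∈ 𝔓.decompositionSubgroup (absoluteGaloisGroup ℚ), θS g ≠ modNCyclotomicCharacter ℚ p g :=
    fun ℓ hℓ 𝔓 h𝔓 ↦ (exists_mem_decompositionSubgroup_apply_ne_cyclotomic_at_p W Φ hCM h5 hram hcard θS θQ hθS hθQ hprod
      hℓ h𝔓).1
  have HQ : ∀ (ℓ : HeightOneSpectrum (𝓞 ℚ)), ((p : ℕ) : 𝓞 ℚ) ∈ ℓ.asIdeal → ∀ 𝔓 ∈ ℓ.primesAbove,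
      ∃ g ∈ 𝔓.decompositionSubgroup (absoluteGaloisGroup ℚ), θQ g ≠ modNCyclotomicCharacter ℚ p g :=
    fun ℓ hℓ 𝔓 h𝔓 ↦ (exists_mem_decompositionSubgroup_apply_ne_cyclotomic_at_p W Φ hCM h5 hram hcard θS θQ hθS hθQ hprod
      hℓ h𝔓).2
  -- a complex conjugation and the parities of the two characters
  obtain ⟨c, hc⟩ := exists_isComplexConjugation (Rat.castHom ℝ)
  have hmc : modNCyclotomicCharacter ℚ m c = -1 :=
    Units.ext (by rw [Units.val_neg, Units.val_one]; exact modNCyclotomicCharacter_of_isComplexConjugation hc)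
  have hpc : modNCyclotomicCharacter ℚ p c = -1 :=
    Units.ext (by rw [Units.val_neg, Units.val_one]; exact modNCyclotomicCharacter_of_isComplexConjugation hc)
  have hSc : θS c = b (-1) := by rw [hSb c, hmc]
  have hQc : θQ c = -1 * (b (-1))⁻¹ := by rw [hQb c, hpc, hmc]
  have hpar := BernoulliUnits.odd_iff_of_teichmuller_lift hp2 b hψ₁
  -- the avatars: `ψ₁` for `θS`, `λ₃ = ψ₁⁻¹↑·ω↑` (level `m·p`) for `θQ`
  haveI : NeZero (m * p) := ⟨Nat.mul_ne_zero (NeZero.ne m) hpr.ne_zero⟩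
  have hlamS : ∀ τ : absoluteGaloisGroup ℚ, ψ₁ ((modNCyclotomicCharacter ℚ m τ : (ZMod m)ˣ) : ZMod m) =
      (((Kato2004.teichmullerChar p (θS τ) : ℤ_[p]ˣ) : ℤ_[p]) : ℚ_[p]) := fun τ ↦ by rw [hSb τ, hψ₁]
  set lam₃ : DirichletCharacter ℚ_[p] (m * p) := changeLevel (dvd_mul_right m p) ψ₁⁻¹ * changeLevel (dvd_mul_left p m) ω
    with hlam₃
  have el₃ : changeLevel (dvd_refl (m * p)) lam₃ = changeLevel (dvd_mul_right m p) ψ₁⁻¹ * changeLevel (dvd_mul_left p m) ω := by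
    rw [hlam₃, changeLevel_self]
  have hlamQ : ∀ τ : absoluteGaloisGroup ℚ, lam₃ ((modNCyclotomicCharacter ℚ (m * p) τ : (ZMod (m * p))ˣ) : ZMod (m * p)) =
      (((Kato2004.teichmullerChar p (θQ τ) : ℤ_[p]ˣ) : ℤ_[p]) : ℚ_[p]) := fun τ ↦ by
    rw [hQb τ]
    exact (BernoulliUnits.avatar_level_of_lift_psiInvOmega hp2 b hψ₁ hω (dvd_refl (m * p)) (dvd_mul_right m p)
      (dvd_mul_left p m) lam₃ el₃ τ).symm
  -- common-level bookkeeping (`M = f·m·p`)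
  have hmpM : m * p ∣ f * m * p := ⟨f, by ring⟩
  have h1M : 1 ∣ f * m * p := one_dvd _
  have hf1M : f * 1 ∣ f * m * p := by rw [mul_one]; exact hfM
  have hL₃ : changeLevel hmpM lam₃ = changeLevel hmM ψ₁⁻¹ * changeLevel hpM ω := by
    rw [hlam₃, map_mul, ← changeLevel_trans, ← changeLevel_trans]
  -- the class-side local inputs at the bad places `≠ p` (w6 g3)
  have hbad' : ∀ v' : HeightOneSpectrum (𝓞 ℚ), ¬ W.HasGoodReductionAt v' → ((p : ℕ) : 𝓞 ℚ) ∉ v'.asIdeal →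
      ∀ P : (W.baseChange (v'.adicCompletion ℚ)).toAffine.Point, p • P = 0 → P = 0 :=
    fun v' hg hpv' ↦ forall_prime_nsmul_eq_zero_adicCompletion_of_bad (K := ℚ) W hCM hram h5 hpv' hg
  have hQI' : ∀ v' : HeightOneSpectrum (𝓞 ℚ), ¬ W.HasGoodReductionAt v' → ((p : ℕ) : 𝓞 ℚ) ∉ v'.asIdeal →
      ∀ 𝔓 ∈ v'.primesAbove, ∀ q : Φ.Quot,
        (∀ g ∈ 𝔓.inertia (absoluteGaloisGroup ℚ), g • q = q) → q = 0 :=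
    fun v' hg hpv' 𝔓 h𝔓 q hq ↦ quot_eq_zero_of_forall_inertia_smul_eq_of_bad (K := ℚ) W Φ hCM hram h5 hpv' hg h𝔓 q hq
  rcases e with e | e
  · -- `ψ ~ ψ₁`: the SUB character `θS` is ODD — CASE S says `W` is TRANSVERSE
    have hψ₁odd : ψ₁.Odd := by
      unfold DirichletCharacter.Odd
      rw [BernoulliUnits.apply_neg_one_eq_of_changeLevel_eq hmM ψ₁ e.symm, EisensteinPair.changeLevel_apply_neg_one]
      exact hψ
    have hb1 : b (-1) = -1 := hpar.1.mp hψ₁odd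
    have hθSc : θS c = -1 := by rw [hSc, hb1]
    have hθQc : θQ c = 1 := by rw [hQc, hb1, inv_neg, inv_one, neg_mul_neg, one_mul]
    have hcx : ∀ x : Φ.Sub, c • x = -x := by
      intro x
      rw [hθS c x, hθSc, Units.val_neg, Units.val_one, ZMod.neg_val', ZMod.val_one,
        Nat.mod_eq_of_lt (Nat.sub_lt hpr.pos Nat.one_pos), Nat.cast_sub hpr.one_lt.le, Nat.cast_one, sub_smul,
        one_smul, hpS, zero_sub]
    have hTR := (hS Φ hcard c hc).1 hcx
    -- the count: quotient RELAXED (even, `≤ p`), sub STRICT (odd, `≤ p`)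
    have hL₃' : changeLevel hmpM lam₃ = changeLevel hfM ψ⁻¹ * changeLevel hpM ω := by
      rw [hL₃, map_inv, map_inv, ← e]
    have heven₃ : lam₃.Even := by
      unfold DirichletCharacter.Even
      rw [BernoulliUnits.apply_neg_one_eq_of_changeLevel_eq hmpM lam₃ hL₃', MulChar.mul_apply, map_inv,
        MulChar.inv_apply_eq_inv', EisensteinPair.changeLevel_apply_neg_one, EisensteinPair.changeLevel_apply_neg_one,
        hψ, hωodd, inv_neg, inv_one, neg_mul_neg, one_mul]
    have hB₃ : ‖bernoulliOnePrim (changeLevel (dvd_mul_right (m * p) p) lam₃ *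
        changeLevel (dvd_mul_left p (m * p)) ω⁻¹)‖ = ((p : ℝ) ^ 1)⁻¹ := by
      rw [BernoulliUnits.bernoulliOnePrim_mul_omegaInv_eq_of_lift_psiInvOmega hmpM hfM h1M hpM hf1M lam₃ ψ
        (1 : DirichletCharacter ℚ_[p] 1) ω hL₃' hψ,
        RegularLocusBernoulliPair.bernoulliOnePrim_bernoulliCharOne_of_not_even ψ _ hne]
      exact hBp
    have hB₁ : ‖bernoulliOnePrim ψ₁⁻¹‖ = ((p : ℝ) ^ 1)⁻¹ := by
      rw [BernoulliUnits.bernoulliOnePrim_inv_eq_of_lift_psi hmM hfM ψ₁ ψ (1 : DirichletCharacter ℚ_[p] 1) e.symm hψ,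
        RegularLocusBernoulliPair.bernoulliOnePrim_bernoulliCharOne_of_not_even ψ _ hne]
      exact hBp
    have hQ := SelmerCountClassSide.natCard_h1Unramified_le_pow_of_even_avatar hMW hp2 hcardQ hcontQ hntQ θQ hθQ hkerQ hc
      hθQc HQ lam₃ hlamQ heven₃ hω hB₃
    have hSu := SelmerCountClassSide.natCard_strict_le_pow_of_odd_avatar hMW hp2 hcard hcontS hntS θS hθS hkerS ψ₁ hlamS
      hψ₁odd hB₁ hpv
    calc Nat.card (selmerGroup W (p : ℤ)) ≤ _ := natCard_selmerGroup_le_of_transverse W v Φ hbad' hQI' hTR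
      _ ≤ p ^ 1 * p ^ 1 := Nat.mul_le_mul hQ hSu
      _ = p ^ 2 := by rw [← pow_add]
  · -- `ψ ~ ψ₁⁻¹ω`: the SUB character `θS` is EVEN — CASE S says `W` is ALIGNED
    have hL₁ : changeLevel hmM ψ₁ = changeLevel hfM ψ⁻¹ * changeLevel hpM ω := by
      rw [map_inv, e, map_inv, mul_inv, inv_inv, inv_mul_cancel_right]
    have hψ₁even : ψ₁.Even := by
      unfold DirichletCharacter.Even
      rw [BernoulliUnits.apply_neg_one_eq_of_changeLevel_eq hmM ψ₁ hL₁, MulChar.mul_apply, map_inv,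
        MulChar.inv_apply_eq_inv', EisensteinPair.changeLevel_apply_neg_one, EisensteinPair.changeLevel_apply_neg_one,
        hψ, hωodd, inv_neg, inv_one, neg_mul_neg, one_mul]
    have hb1 : b (-1) = 1 := hpar.2.mp hψ₁even
    have hθSc : θS c = 1 := by rw [hSc, hb1]
    have hcx : ∀ x : Φ.Sub, c • x = x := by
      intro x
      rw [hθS c x, hθSc, Units.val_one, ZMod.val_one, Nat.cast_one, one_smul]
    have hAL := (hS Φ hcard c hc).2 hcx
    -- the count: quotient STRICT (odd, `≤ p`), sub RELAXED (even, `≤ p`)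
    have hL₃' : changeLevel hmpM lam₃ = changeLevel hfM ψ := by rw [hL₃, ← e]
    have hodd₃ : lam₃.Odd := by
      unfold DirichletCharacter.Odd
      rw [BernoulliUnits.apply_neg_one_eq_of_changeLevel_eq hmpM lam₃ hL₃', EisensteinPair.changeLevel_apply_neg_one]
      exact hψ
    have hB₃ : ‖bernoulliOnePrim lam₃⁻¹‖ = ((p : ℝ) ^ 1)⁻¹ := by
      rw [BernoulliUnits.bernoulliOnePrim_inv_eq_of_lift_psi hmpM hfM lam₃ ψ (1 : DirichletCharacter ℚ_[p] 1) hL₃' hψ,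
        RegularLocusBernoulliPair.bernoulliOnePrim_bernoulliCharOne_of_not_even ψ _ hne]
      exact hBp
    have hB₁ : ‖bernoulliOnePrim (changeLevel (dvd_mul_right m p) ψ₁ * changeLevel (dvd_mul_left p m) ω⁻¹)‖ =
        ((p : ℝ) ^ 1)⁻¹ := by
      rw [BernoulliUnits.bernoulliOnePrim_mul_omegaInv_eq_of_lift_psiInvOmega hmM hfM h1M hpM hf1M ψ₁ ψ
        (1 : DirichletCharacter ℚ_[p] 1) ω hL₁ hψ,
        RegularLocusBernoulliPair.bernoulliOnePrim_bernoulliCharOne_of_not_even ψ _ hne]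
      exact hBp
    have hQ := SelmerCountClassSide.natCard_strict_le_pow_of_odd_avatar hMW hp2 hcardQ hcontQ hntQ θQ hθQ hkerQ lam₃ hlamQ
      hodd₃ hB₃ hpv
    have hSu := SelmerCountClassSide.natCard_h1Unramified_le_pow_of_even_avatar hMW hp2 hcard hcontS hntS θS hθS hkerS hc
      hθSc HS ψ₁ hlamS hψ₁even hω hB₁
    calc Nat.card (selmerGroup W (p : ℤ)) ≤ _ := natCard_selmerGroup_le_of_aligned W v Φ hbad' hQI' hAL
      _ ≤ p ^ 1 * p ^ 1 := Nat.mul_le_mul hQ hSu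
      _ = p ^ 2 := by rw [← pow_add]

/-- **B1 ON THE FIRST-ORDER BRANCH, modulo Mazur–Wiles, Cassels–Tate and GZK: `BSD(W,p)` from `p ∤ #Ш_an(W)`.** Same class member and
datum, `‖B_{1,ψ⁻¹}‖_p = p⁻¹`, CASE S, `hMW`; moreover `r_an(W) = 1`, the Cassels–Tate pairing (`hCT`), Gross–Zagier–Kolyvagin (`hGZK`,
the crux's own antecedent) and `#Ш_an(W) = q ∈ ℚ` with `padicValRat p q = 0`. THEN `BSDp W p`
(`natCard_selmerGroup_le_sq_of_caseS` + w2 g8's `ParitySplit.bsdp_of_natCard_selmerGroup_le_sq`). This is LEAD g11's «on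
B1 ∩ {#Sel_p ≤ p²}, BSD_p ⟺ p ∤ #Ш_an(W)» with the Selmer condition DISCHARGED from `v_p(B_{1,ψ⁻¹}) = 1` and CASE S.
[cite: Cassels1962ArithmeticIV] [cite: Miller2011LMS, Def. 1.1] [cite: MazurWiles1984, Thm. 2 (p. 216)] -/
theorem bsdp_of_caseS_of_shaAnUnit (hMW : MazurWiles1984.thm2_card_oddChiClassGroup_eq_bernoulli)
    (hCT : exists_casselsTate_pairing (K := ℚ)) (hGZK : rank_eq_analyticRank_of_analyticRank_le_one)
    (hCM : W.HasCM) (hram : CMRamified W p) (h5 : 5 ≤ p) (hr : W.analyticRank = 1)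
    {f : ℕ} [NeZero f] (ψ : DirichletCharacter ℚ_[p] f) (ω : DirichletCharacter ℚ_[p] p)
    (hψ : ψ.Odd) (hω : IsTeichmullerCharacter ω)
    (hss : ∀ ℓ : ℕ, ℓ.Prime → ¬ (ℓ ∣ p * W.conductorNorm ℤ) →
      ‖((W.LFunction ℓ : ℤ) : ℚ_[p]) - (ψ (ℓ : ZMod f) + ψ⁻¹ (ℓ : ZMod f) * ω (ℓ : ZMod p))‖ < 1)
    (hB : ‖bernoulliOnePrim ψ⁻¹‖ = (p : ℝ)⁻¹)
    {q : ℚ} (hq : shaAn W = (q : ℂ)) (hvq : padicValRat p q = 0)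
    {v : HeightOneSpectrum (𝓞 ℚ)} (hpv : ((p : ℕ) : 𝓞 ℚ) ∈ v.asIdeal)
    (hS : ∀ (Φ : StableSubgroup (absoluteGaloisGroup ℚ) (geomTorsion W (p : ℤ))), Nat.card Φ.Sub = p →
      ∀ c : absoluteGaloisGroup ℚ, IsComplexConjugation (Rat.castHom ℝ) c →
        ((∀ x : Φ.Sub, c • x = -x) →
          ∀ w : contOneCocycles (discreteTopRep (absoluteGaloisGroup ℚ) Φ.Sub),
            oneCocycleClass (discreteTopRep (absoluteGaloisGroup ℚ) (geomTorsion W (p : ℤ)))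
              (contOneCocycles.pullback (ContinuousMonoidHom.id _)
                (resHomOfEquivariant (ContinuousMonoidHom.id _) Φ.incl Φ.incl_smul) w) ∈ selmerGroup W (p : ℤ) →
              ∃ s : Φ.Sub, ∀ g ∈ decomp v, w.1 g = g • s - s) ∧
        ((∀ x : Φ.Sub, c • x = x) →
          ∀ z : contOneCocycles (discreteTopRep (absoluteGaloisGroup ℚ) (geomTorsion W (p : ℤ))),
            oneCocycleClass _ z ∈ selmerGroup W (p : ℤ) →
              ∃ q : Φ.Quot, ∀ g ∈ decomp v, Φ.proj (z.1 g) = g • q - q)) :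
    BSDp W p :=
  ParitySplit.bsdp_of_natCard_selmerGroup_le_sq W p hCT hGZK hr hq hvq
    (natCard_selmerGroup_le_sq_of_caseS W hMW hCM hram h5 ψ ω hψ hω hss hB hpv hS)

/-- **(append) ON THE FIRST-ORDER BRANCH `Ш(W)[p] = 0`, modulo Mazur–Wiles, Cassels–Tate and GZK.** Same class member and datum,
`‖B_{1,ψ⁻¹}‖_p = p⁻¹`, CASE S, `hMW`, `r_an(W) = 1`, `hCT`, `hGZK`: every element of `Ш(W/ℚ)` killed by `p` is zero
(`natCard_selmerGroup_le_sq_of_caseS` + w3 g8's `ParitySplit.noPTorsion_of_natCard_selmerGroup_le_sq`: `dim_𝔽_p Ш[p]` is even).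
So on this branch the (β) alternative «`Ш(W)[p] ≠ 0`» of LEAD g10's level dictionary is EXCLUDED — `Ш` is not the obstruction to B1 there
(w2 g8 notes §4(c)). [cite: Cassels1962ArithmeticIV] [cite: MazurWiles1984, Thm. 2 (p. 216)] -/
theorem sha_noPTorsion_of_caseS (hMW : MazurWiles1984.thm2_card_oddChiClassGroup_eq_bernoulli)
    (hCT : exists_casselsTate_pairing (K := ℚ)) (hGZK : rank_eq_analyticRank_of_analyticRank_le_one)
    (hCM : W.HasCM) (hram : CMRamified W p) (h5 : 5 ≤ p) (hr : W.analyticRank = 1)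
    {f : ℕ} [NeZero f] (ψ : DirichletCharacter ℚ_[p] f) (ω : DirichletCharacter ℚ_[p] p)
    (hψ : ψ.Odd) (hω : IsTeichmullerCharacter ω)
    (hss : ∀ ℓ : ℕ, ℓ.Prime → ¬ (ℓ ∣ p * W.conductorNorm ℤ) →
      ‖((W.LFunction ℓ : ℤ) : ℚ_[p]) - (ψ (ℓ : ZMod f) + ψ⁻¹ (ℓ : ZMod f) * ω (ℓ : ZMod p))‖ < 1)
    (hB : ‖bernoulliOnePrim ψ⁻¹‖ = (p : ℝ)⁻¹)
    {v : HeightOneSpectrum (𝓞 ℚ)} (hpv : ((p : ℕ) : 𝓞 ℚ) ∈ v.asIdeal)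
    (hS : ∀ (Φ : StableSubgroup (absoluteGaloisGroup ℚ) (geomTorsion W (p : ℤ))), Nat.card Φ.Sub = p →
      ∀ c : absoluteGaloisGroup ℚ, IsComplexConjugation (Rat.castHom ℝ) c →
        ((∀ x : Φ.Sub, c • x = -x) →
          ∀ w : contOneCocycles (discreteTopRep (absoluteGaloisGroup ℚ) Φ.Sub),
            oneCocycleClass (discreteTopRep (absoluteGaloisGroup ℚ) (geomTorsion W (p : ℤ)))
              (contOneCocycles.pullback (ContinuousMonoidHom.id _)
                (resHomOfEquivariant (ContinuousMonoidHom.id _) Φ.incl Φ.incl_smul) w) ∈ selmerGroup W (p : ℤ) →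
              ∃ s : Φ.Sub, ∀ g ∈ decomp v, w.1 g = g • s - s) ∧
        ((∀ x : Φ.Sub, c • x = x) →
          ∀ z : contOneCocycles (discreteTopRep (absoluteGaloisGroup ℚ) (geomTorsion W (p : ℤ))),
            oneCocycleClass _ z ∈ selmerGroup W (p : ℤ) →
              ∃ q : Φ.Quot, ∀ g ∈ decomp v, Φ.proj (z.1 g) = g • q - q)) :
    ∀ x : W.sha, (p : ℤ) • x = 0 → x = 0 :=
  ParitySplit.noPTorsion_of_natCard_selmerGroup_le_sq W p hCT hGZK hr
    (natCard_selmerGroup_le_sq_of_caseS W hMW hCM hram h5 ψ ω hψ hω hss hB hpv hS)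

/-- **(append) ON THE FIRST-ORDER BRANCH, `BSD(W,p) ⟺ p ∤ #Ш_an(W)`** (modulo Mazur–Wiles, Cassels–Tate, GZK) — LEAD g11's reading
(22:11:05Z (1)) with its Selmer condition discharged from `‖B_{1,ψ⁻¹}‖_p = p⁻¹` and CASE S
(`natCard_selmerGroup_le_sq_of_caseS` + w3 g8's `ParitySplit.bsdp_iff_shaAn_unit_of_natCard_selmerGroup_le_sq`).
[cite: Cassels1962ArithmeticIV] [cite: Miller2011LMS, Def. 1.1] [cite: MazurWiles1984, Thm. 2 (p. 216)] -/
theorem bsdp_iff_shaAnUnit_of_caseS (hMW : MazurWiles1984.thm2_card_oddChiClassGroup_eq_bernoulli)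
    (hCT : exists_casselsTate_pairing (K := ℚ)) (hGZK : rank_eq_analyticRank_of_analyticRank_le_one)
    (hCM : W.HasCM) (hram : CMRamified W p) (h5 : 5 ≤ p) (hr : W.analyticRank = 1)
    {f : ℕ} [NeZero f] (ψ : DirichletCharacter ℚ_[p] f) (ω : DirichletCharacter ℚ_[p] p)
    (hψ : ψ.Odd) (hω : IsTeichmullerCharacter ω)
    (hss : ∀ ℓ : ℕ, ℓ.Prime → ¬ (ℓ ∣ p * W.conductorNorm ℤ) →
      ‖((W.LFunction ℓ : ℤ) : ℚ_[p]) - (ψ (ℓ : ZMod f) + ψ⁻¹ (ℓ : ZMod f) * ω (ℓ : ZMod p))‖ < 1)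
    (hB : ‖bernoulliOnePrim ψ⁻¹‖ = (p : ℝ)⁻¹)
    {v : HeightOneSpectrum (𝓞 ℚ)} (hpv : ((p : ℕ) : 𝓞 ℚ) ∈ v.asIdeal)
    (hS : ∀ (Φ : StableSubgroup (absoluteGaloisGroup ℚ) (geomTorsion W (p : ℤ))), Nat.card Φ.Sub = p →
      ∀ c : absoluteGaloisGroup ℚ, IsComplexConjugation (Rat.castHom ℝ) c →
        ((∀ x : Φ.Sub, c • x = -x) →
          ∀ w : contOneCocycles (discreteTopRep (absoluteGaloisGroup ℚ) Φ.Sub),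
            oneCocycleClass (discreteTopRep (absoluteGaloisGroup ℚ) (geomTorsion W (p : ℤ)))
              (contOneCocycles.pullback (ContinuousMonoidHom.id _)
                (resHomOfEquivariant (ContinuousMonoidHom.id _) Φ.incl Φ.incl_smul) w) ∈ selmerGroup W (p : ℤ) →
              ∃ s : Φ.Sub, ∀ g ∈ decomp v, w.1 g = g • s - s) ∧
        ((∀ x : Φ.Sub, c • x = x) →
          ∀ z : contOneCocycles (discreteTopRep (absoluteGaloisGroup ℚ) (geomTorsion W (p : ℤ))),
            oneCocycleClass _ z ∈ selmerGroup W (p : ℤ) →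
              ∃ q : Φ.Quot, ∀ g ∈ decomp v, Φ.proj (z.1 g) = g • q - q)) :
    BSDp W p ↔ ∃ q : ℚ, shaAn W = (q : ℂ) ∧ padicValRat p q = 0 :=
  ParitySplit.bsdp_iff_shaAn_unit_of_natCard_selmerGroup_le_sq W p hCT hGZK hr
    (natCard_selmerGroup_le_sq_of_caseS W hMW hCM hram h5 ψ ω hψ hω hss hB hpv hS)

/-- **(append) LEAD g11's «B1-sha» is VACUOUS on the first-order branch.** In the currency of `EisensteinEndStateV19Binders` (B1-sha :=
«class member, `r_an = 1`, `∃ s ∈ W.sha, s ≠ 0 ∧ p • s = 0` ⟹ `BSDp W p`»): for a member with `‖B_{1,ψ⁻¹}‖_p = p⁻¹` in CASE S (modulo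
`hMW`, `hCT`, `hGZK`) the premise of B1-sha is contradictory (`sha_noPTorsion_of_caseS`), so B1-sha holds there — only B1-level (the
invisible generator; there equivalent to `p ∤ #Ш_an(W)`, `bsdp_iff_shaAnUnit_of_caseS`) carries content on this branch.
[cite: Cassels1962ArithmeticIV] [cite: MazurWiles1984, Thm. 2 (p. 216)] -/
theorem bsdp_of_sha_ne_zero_of_caseS (hMW : MazurWiles1984.thm2_card_oddChiClassGroup_eq_bernoulli)
    (hCT : exists_casselsTate_pairing (K := ℚ)) (hGZK : rank_eq_analyticRank_of_analyticRank_le_one)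
    (hCM : W.HasCM) (hram : CMRamified W p) (h5 : 5 ≤ p) (hr : W.analyticRank = 1)
    {f : ℕ} [NeZero f] (ψ : DirichletCharacter ℚ_[p] f) (ω : DirichletCharacter ℚ_[p] p)
    (hψ : ψ.Odd) (hω : IsTeichmullerCharacter ω)
    (hss : ∀ ℓ : ℕ, ℓ.Prime → ¬ (ℓ ∣ p * W.conductorNorm ℤ) →
      ‖((W.LFunction ℓ : ℤ) : ℚ_[p]) - (ψ (ℓ : ZMod f) + ψ⁻¹ (ℓ : ZMod f) * ω (ℓ : ZMod p))‖ < 1)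
    (hB : ‖bernoulliOnePrim ψ⁻¹‖ = (p : ℝ)⁻¹)
    {v : HeightOneSpectrum (𝓞 ℚ)} (hpv : ((p : ℕ) : 𝓞 ℚ) ∈ v.asIdeal)
    (hS : ∀ (Φ : StableSubgroup (absoluteGaloisGroup ℚ) (geomTorsion W (p : ℤ))), Nat.card Φ.Sub = p →
      ∀ c : absoluteGaloisGroup ℚ, IsComplexConjugation (Rat.castHom ℝ) c →
        ((∀ x : Φ.Sub, c • x = -x) →
          ∀ w : contOneCocycles (discreteTopRep (absoluteGaloisGroup ℚ) Φ.Sub),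
            oneCocycleClass (discreteTopRep (absoluteGaloisGroup ℚ) (geomTorsion W (p : ℤ)))
              (contOneCocycles.pullback (ContinuousMonoidHom.id _)
                (resHomOfEquivariant (ContinuousMonoidHom.id _) Φ.incl Φ.incl_smul) w) ∈ selmerGroup W (p : ℤ) →
              ∃ s : Φ.Sub, ∀ g ∈ decomp v, w.1 g = g • s - s) ∧
        ((∀ x : Φ.Sub, c • x = x) →
          ∀ z : contOneCocycles (discreteTopRep (absoluteGaloisGroup ℚ) (geomTorsion W (p : ℤ))),
            oneCocycleClass _ z ∈ selmerGroup W (p : ℤ) →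
              ∃ q : Φ.Quot, ∀ g ∈ decomp v, Φ.proj (z.1 g) = g • q - q))
    (hsha : ∃ s ∈ W.sha, s ≠ 0 ∧ p • s = 0) : BSDp W p := by
  exfalso
  obtain ⟨s, hs, hs0, hps⟩ := hsha
  have h := sha_noPTorsion_of_caseS W hMW hCT hGZK hCM hram h5 hr ψ ω hψ hω hss hB hpv hS ⟨s, hs⟩
    (Subtype.ext (by rw [AddSubgroupClass.coe_zsmul, ZeroMemClass.coe_zero, natCast_zsmul]; exact hps))
  exact hs0 (congrArg Subtype.val h)

end Summit.BirchSwinnertonDyer.BirchSwinnertonDyer.Theorems.PrintCFram.SelmerCount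

end
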